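import Summits.CriticalPhenomena.Ising3DConformalLimit.Theses.EnergyNotSigmaSquared
import Literature.Probability.LatticeModels.CriticalUrsellFourSign

/-!
# `GapForcesFarMerging` is not soft, I: shapes, package, explicit families (crux stmt-CriticalPhenomena-4468)

Part 1/4 — DEFINITIONS and the anatomy of the crux: the abstract GAP / far-merging / one-ended
shapes (`GapShape`, `FarMergingShape`, `OneEndedGapShape`; `crux_iff_shapes`: the crux is literally
"GAP shape ⇒ far-merging shape" for the critical correlators), `not_crux_iff` (a disproof is
`EnergyGapPowerLaw ∧ ¬FarMerging`), the reformulation `energyGapPowerLaw_iff_adjacentWickDefect`,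
the glue `energyGapSoft_of_energyGapPowerLaw` (item 4469 ⇒ 4473), the 22-field `SoftPackage`, and
the explicit families `F_θ = Wick - 2·Pmin·θ` over the kernel `S₀(a,b) = 1/(1+‖b-a‖_∞)`
(`θ_A, θ_B, θ_C`). Parts 2–4 (`SoftKernel`, `SoftFamilies`, `SoftVerdicts`) carry the proofs.

Split (Theorems files are ≤ 400 lines) of the theorem content of the standing adversary's work file
`Summits/CriticalPhenomena/Ising3DConformalLimit/Cruxes/GapForcesFarMerging/Disproof.lean`
(crux `stmt-CriticalPhenomena-4468`, route `EnergyNotSigmaSquared`), landed under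
`Theorems/GapForcesFarMerging/Negative/` so that ideators, planners and provers can import it.

## References

* M. Aizenman, Comm. Math. Phys. 86 (1982) 1–48 [AizenmanCMP1982].
* M. Aizenman, H. Duminil-Copin, Ann. Math. 194 (2021), §3 eqs. (3.7), (3.11)–(3.12)
  [AizenmanDuminilCopinAnnals2021].
* J. L. Lebowitz, Comm. Math. Phys. 35 (1974) 87–92 [Lebowitz1974].
* H. Duminil-Copin, R. Panis, arXiv:2404.05700, Thm 1.8 [DuminilCopinPanis2025LowerBounds].
-/

noncomputable section

namespace Summit.CriticalPhenomena.Ising3DConformalLimit.Theorems.GapForcesFarMerging.Negative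

open Literature.Probability.LatticeModels
open Summit.CriticalPhenomena.Ising3DConformalLimit.Theses.EnergyNotSigmaSquared

/-- The lattice direction `e₂ = (0,1,0)` used by the crux. [folklore] -/
abbrev e₂ : Site 3 := Pi.single 1 1

/-- Pair correlator of the critical state as a two-argument kernel. [folklore] -/
abbrev cc2 (a b : Site 3) : ℝ := criticalCorr 3 2 ![a, b]

/-- GAP-shape of an abstract triple (pair kernel `S`, two-point `T`, four-point `F`): the text of
`EnergyGapPowerLaw` with `criticalCorr 3 2 ![a,b] ↦ S a b`, `criticalTwoPoint 3 ↦ T`, `criticalCorr 3 4 ↦ F`. [folklore] -/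
def GapShape (S : Site 3 → Site 3 → ℝ) (T : Site 3 → ℝ) (F : (Fin 4 → Site 3) → ℝ) : Prop :=
  ∃ κ C : ℝ, 0 < κ ∧ ∀ x : Site 3, x ≠ 0 →
    F ![0, e₂, x, x + e₂] - S 0 e₂ * S x (x + e₂) ≤ C * (‖x‖ : ℝ) ^ (-κ) * T x ^ 2

/-- Far-merging shape (the crux's conclusion) for an abstract pair kernel `S` and four-point `F`. [folklore] -/
def FarMergingShape (S : Site 3 → Site 3 → ℝ) (F : (Fin 4 → Site 3) → ℝ) : Prop :=
  ∃ c : ℝ, 0 < c ∧ ∃ x : Fin 4 → Site 3, Function.Injective x ∧ ∀ L₀ : ℕ, ∃ L : ℕ, L₀ ≤ L ∧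
    F (fun i => (L : ℤ) • x i) - (S ((L : ℤ) • x 0) ((L : ℤ) • x 1) * S ((L : ℤ) • x 2) ((L : ℤ) • x 3)
      + S ((L : ℤ) • x 0) ((L : ℤ) • x 2) * S ((L : ℤ) • x 1) ((L : ℤ) • x 3)
      + S ((L : ℤ) • x 0) ((L : ℤ) • x 3) * S ((L : ℤ) • x 1) ((L : ℤ) • x 2))
      ≤ -(c * (S ((L : ℤ) • x 0) ((L : ℤ) • x 1) * S ((L : ℤ) • x 2) ((L : ℤ) • x 3)))

/-- `EnergyGapPowerLaw` is literally the GAP shape of `(cc2, criticalTwoPoint 3, criticalCorr 3 4)`. [folklore] -/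
theorem energyGapPowerLaw_iff_gapShape :
    EnergyGapPowerLaw ↔ GapShape cc2 (criticalTwoPoint 3) (criticalCorr 3 4) := Iff.rfl

/-- The crux is literally "GAP shape ⇒ far-merging shape" for the critical correlators. [folklore] -/
theorem crux_iff_shapes :
    GapForcesFarMerging ↔
      (GapShape cc2 (criticalTwoPoint 3) (criticalCorr 3 4) → FarMergingShape cc2 (criticalCorr 3 4)) :=
  Iff.rfl

/-- `GapForcesFarMerging ↔ (EnergyGapPowerLaw → far-merging shape of the critical correlators)`. [folklore] -/
theorem crux_iff : GapForcesFarMerging ↔ (EnergyGapPowerLaw → FarMergingShape cc2 (criticalCorr 3 4)) :=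
  Iff.rfl

/-- The crux's conclusion is verbatim the hypothesis of item 4471 `FarMergingGivesU4`. [folklore] -/
theorem farMergingGivesU4_iff :
    FarMergingGivesU4 ↔ (FarMergingShape cc2 (criticalCorr 3 4) →
      ∀ (ρ : ℝ → ℝ) (S : CorrFamily 3), (∀ δ ∈ Set.Ioc (0:ℝ) 1, 0 < ρ δ) →
      HasPointwiseScalingLimit (criticalCorr 3) ρ S → IsNondegenerateTwoPoint S → HasNontrivialU4 S) :=
  Iff.rfl

/-- The conclusion alone proves the crux. [folklore] -/
theorem crux_of_farMerging (h : FarMergingShape cc2 (criticalCorr 3 4)) : GapForcesFarMerging :=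
  fun _ => h

/-- The failure of GAP alone proves the crux. [folklore] -/
theorem crux_of_not_gap (h : ¬ EnergyGapPowerLaw) : GapForcesFarMerging := fun hg => (h hg).elim

/-- A disproof of the crux is exactly `EnergyGapPowerLaw ∧ ¬FarMerging` (GAP together with lattice
Gaussianity of `U₄` along every dilation of every injective shape). [folklore] -/
theorem not_crux_iff :
    ¬ GapForcesFarMerging ↔ (EnergyGapPowerLaw ∧ ¬ FarMergingShape cc2 (criticalCorr 3 4)) := by
  rw [crux_iff, Classical.not_imp]

/-- The lattice Ursell function of the critical state on `ℤ³`. [cite: AizenmanDuminilCopinAnnals2021, eq. (3.11)] -/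
def U4 (y : Fin 4 → Site 3) : ℝ :=
  criticalCorr 3 4 y - (cc2 (y 0) (y 1) * cc2 (y 2) (y 3) + cc2 (y 0) (y 2) * cc2 (y 1) (y 3)
    + cc2 (y 0) (y 3) * cc2 (y 1) (y 2))

/-- **GAP ⟺ the Wick defect of `|U₄|` at adjacent quadruples decays as a power**: with the cross
Wick terms `W(x) = ⟨σ₀σ_x⟩⟨σ_{e₂}σ_{x+e₂}⟩ + ⟨σ₀σ_{x+e₂}⟩⟨σ_{e₂}σ_x⟩`, `EnergyGapPowerLaw` says
`W(x) + U₄(0,e₂,x,x+e₂) ≤ C‖x‖^{-κ}⟨σ₀σ_x⟩²` (pure algebra: `⟨ε₀;ε_x⟩ = U₄ + W`). [folklore] -/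
theorem energyGapPowerLaw_iff_adjacentWickDefect :
    EnergyGapPowerLaw ↔ ∃ κ C : ℝ, 0 < κ ∧ ∀ x : Site 3, x ≠ 0 →
      (cc2 0 x * cc2 e₂ (x + e₂) + cc2 0 (x + e₂) * cc2 e₂ x) + U4 ![0, e₂, x, x + e₂]
        ≤ C * (‖x‖ : ℝ) ^ (-κ) * criticalTwoPoint 3 x ^ 2 := by
  have key : ∀ x : Site 3,
      (cc2 0 x * cc2 e₂ (x + e₂) + cc2 0 (x + e₂) * cc2 e₂ x) + U4 ![0, e₂, x, x + e₂] =
        criticalCorr 3 4 ![0, e₂, x, x + e₂] - cc2 0 e₂ * cc2 x (x + e₂) := by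
    intro x
    simp only [U4, Matrix.cons_val_zero, Matrix.cons_val_one, Matrix.cons_val]
    ring
  constructor
  · rintro ⟨κ, C, hκ, h⟩
    exact ⟨κ, C, hκ, fun x hx => by rw [key]; exact h x hx⟩
  · rintro ⟨κ, C, hκ, h⟩
    exact ⟨κ, C, hκ, fun x hx => by rw [← key]; exact h x hx⟩

/-- Under GAP, `-U₄` at the adjacent quadruple is at least the cross Wick terms minus
`C‖x‖^{-κ}G(x)²`, and `U₄ ≤ 0` (Lebowitz, `criticalUrsellFour_nonpos`). [cite: Lebowitz1974, Theorem, eq. (2.5b)] -/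
theorem adjacent_ursell_sandwich_of_gap (h : EnergyGapPowerLaw) :
    ∃ κ C : ℝ, 0 < κ ∧ ∀ x : Site 3, x ≠ 0 →
      (cc2 0 x * cc2 e₂ (x + e₂) + cc2 0 (x + e₂) * cc2 e₂ x) - C * (‖x‖ : ℝ) ^ (-κ) * criticalTwoPoint 3 x ^ 2
        ≤ -U4 ![0, e₂, x, x + e₂] ∧ U4 ![0, e₂, x, x + e₂] ≤ 0 := by
  obtain ⟨κ, C, hκ, hC⟩ := energyGapPowerLaw_iff_adjacentWickDefect.1 h
  refine ⟨κ, C, hκ, fun x hx => ⟨by linarith [hC x hx], ?_⟩⟩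
  have := criticalUrsellFour_nonpos (d := 3) le_rfl ![0, e₂, x, x + e₂]
  simpa [U4] using this

/-- **GAP ⟹ EnergyGapSoft** (item 4469 implies item 4473: a power of `‖x‖` is eventually below any
`ε`; the guard `x ≠ 0` follows from `‖x‖ ≥ R ≥ 1`). [folklore] -/
theorem energyGapSoft_of_energyGapPowerLaw (h : EnergyGapPowerLaw) : EnergyGapSoft := by
  obtain ⟨κ, C, hκ, hC⟩ := h
  intro ε hε
  set M : ℝ := max C 0 with hM
  have hM0 : 0 ≤ M := le_max_right _ _
  -- choose R ≥ 1 with M * R^(-κ) ≤ ε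
  set R : ℝ := max 1 (((M + 1) / ε) ^ (1 / κ)) with hR
  refine ⟨R, fun x hxR => ?_⟩
  have hR1 : (1 : ℝ) ≤ R := le_max_left _ _
  have hxpos : (0 : ℝ) < ‖x‖ := lt_of_lt_of_le one_pos (hR1.trans hxR)
  have hx0 : x ≠ 0 := by
    intro h0; rw [h0, norm_zero] at hxpos; exact lt_irrefl _ hxpos
  have hG2 : 0 ≤ criticalTwoPoint 3 x ^ 2 := sq_nonneg _
  have hpow_le : (‖x‖ : ℝ) ^ (-κ) ≤ R ^ (-κ) :=
    Real.rpow_le_rpow_of_nonpos (lt_of_lt_of_le one_pos hR1) hxR (by linarith)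
  have hRk : R ^ (-κ) ≤ ε / (M + 1) := by
    have hb : 0 < (M + 1) / ε := by positivity
    have h1 : ((M + 1) / ε) ^ (1 / κ) ≤ R := le_max_right _ _
    have h2 : R ^ (-κ) ≤ (((M + 1) / ε) ^ (1 / κ)) ^ (-κ) :=
      Real.rpow_le_rpow_of_nonpos (Real.rpow_pos_of_pos hb _) h1 (by linarith)
    refine h2.trans (le_of_eq ?_)
    rw [← Real.rpow_mul hb.le, show (1 / κ) * (-κ) = -1 by field_simp, Real.rpow_neg_one, inv_div]
  calc criticalCorr 3 4 ![0, (Pi.single 1 1 : Site 3), x, x + Pi.single 1 1]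
        - criticalCorr 3 2 ![0, (Pi.single 1 1 : Site 3)] * criticalCorr 3 2 ![x, x + Pi.single 1 1]
      ≤ C * (‖x‖ : ℝ) ^ (-κ) * criticalTwoPoint 3 x ^ 2 := hC x hx0
    _ ≤ M * (‖x‖ : ℝ) ^ (-κ) * criticalTwoPoint 3 x ^ 2 :=
        mul_le_mul_of_nonneg_right
          (mul_le_mul_of_nonneg_right (le_max_left _ _) (Real.rpow_nonneg (norm_nonneg _) _)) hG2
    _ ≤ M * (R ^ (-κ)) * criticalTwoPoint 3 x ^ 2 := by gcongr
    _ ≤ M * (ε / (M + 1)) * criticalTwoPoint 3 x ^ 2 := by gcongr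
    _ ≤ ε * criticalTwoPoint 3 x ^ 2 := by
        apply mul_le_mul_of_nonneg_right _ hG2
        rw [mul_div_assoc']
        rw [div_le_iff₀ (by positivity)]
        nlinarith

/-- Coordinate sign flip `x_k ↦ -x_k`. [folklore] -/
def flipAt (k : Fin 3) (v : Site 3) : Site 3 := Function.update v k (-v k)

/-- The soft package. [folklore] -/
structure SoftPackage (S : Site 3 → Site 3 → ℝ) (T : Site 3 → ℝ) (F : (Fin 4 → Site 3) → ℝ) :
    Prop where
  two : ∀ x, T x = S 0 x
  symm : ∀ a b, S a b = S b a
  transl : ∀ a b v, S (a + v) (b + v) = S a b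
  perm : ∀ (π : Equiv.Perm (Fin 3)) (a b : Site 3), S (a ∘ ⇑π) (b ∘ ⇑π) = S a b
  refl : ∀ (k : Fin 3) (a b : Site 3), S (flipAt k a) (flipAt k b) = S a b
  diag : ∀ a, S a a = 1
  pos : ∀ a b, 0 < S a b
  le_one : ∀ a b, S a b ≤ 1
  upper : ∃ C : ℝ, ∀ x : Site 3, x ≠ 0 → S 0 x ≤ C * (‖x‖ : ℝ) ^ (-(1 : ℝ))
  lower : ∃ c : ℝ, 0 < c ∧ ∀ x : Site 3, x ≠ 0 → c * (‖x‖ : ℝ) ^ (-(2 : ℝ)) ≤ S 0 x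
  mms : ∀ v w : Site 3, 3 * ‖v‖ ≤ ‖w‖ → S 0 w ≤ S 0 v
  gks_pair : ∀ a b c, S a b * S b c ≤ S a c
  bubble : ¬ Summable (fun x : Site 3 => S 0 x ^ 2)
  swap01 : ∀ y, F (y ∘ ⇑(Equiv.swap (0 : Fin 4) 1)) = F y
  swap12 : ∀ y, F (y ∘ ⇑(Equiv.swap (1 : Fin 4) 2)) = F y
  swap23 : ∀ y, F (y ∘ ⇑(Equiv.swap (2 : Fin 4) 3)) = F y
  translF : ∀ y v, F (fun i => y i + v) = F y
  coincide : ∀ a x z, F ![a, a, x, z] = S x z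
  nonneg : ∀ y, 0 ≤ F y
  griffiths : ∀ y, S (y 0) (y 1) * S (y 2) (y 3) ≤ F y
  lebowitz : ∀ y, F y - (S (y 0) (y 1) * S (y 2) (y 3) + S (y 0) (y 2) * S (y 1) (y 3)
    + S (y 0) (y 3) * S (y 1) (y 2)) ≤ 0
  aizenman : ∀ y, -(2 * (S (y 0) (y 1) * S (y 2) (y 3))) ≤ F y - (S (y 0) (y 1) * S (y 2) (y 3)
    + S (y 0) (y 2) * S (y 1) (y 3) + S (y 0) (y 3) * S (y 1) (y 2))

/-- `g(v) = 1/(1 + ‖v‖_∞)`. [folklore] -/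
def g (v : Site 3) : ℝ := (1 + ‖v‖)⁻¹

/-- The pair kernel `S₀(a,b) = g(b - a)`. [folklore] -/
def S₀ (a b : Site 3) : ℝ := g (b - a)

/-- Its two-point function. [folklore] -/
def T₀ (x : Site 3) : ℝ := S₀ 0 x

section pairings
variable (S : Site 3 → Site 3 → ℝ)

/-- The three pairing products. [folklore] -/
def P₁ (y : Fin 4 → Site 3) : ℝ := S (y 0) (y 1) * S (y 2) (y 3)

/-- The three pairing products. [folklore] -/
def P₂ (y : Fin 4 → Site 3) : ℝ := S (y 0) (y 2) * S (y 1) (y 3)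

/-- The three pairing products. [folklore] -/
def P₃ (y : Fin 4 → Site 3) : ℝ := S (y 0) (y 3) * S (y 1) (y 2)

/-- Wick sum. [folklore] -/
def wick (y : Fin 4 → Site 3) : ℝ := P₁ S y + P₂ S y + P₃ S y

/-- Smallest pairing product. [folklore] -/
def pmin (y : Fin 4 → Site 3) : ℝ := min (min (P₁ S y) (P₂ S y)) (P₃ S y)

end pairings

/-- Minimal pairwise sup-distance of a quadruple. [folklore] -/
def sep (y : Fin 4 → Site 3) : ℝ :=
  min ‖y 0 - y 1‖ (min ‖y 0 - y 2‖ (min ‖y 0 - y 3‖ (min ‖y 1 - y 2‖ (min ‖y 1 - y 3‖ ‖y 2 - y 3‖))))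

/-- The `θ`-deformed Wick four-point function `F_θ = Wick − 2·Pmin·θ` (so `U₄ = −2·Pmin·θ`). [folklore] -/
def Fθ (θ : (Fin 4 → Site 3) → ℝ) (y : Fin 4 → Site 3) : ℝ := wick S₀ y - 2 * pmin S₀ y * θ y

/-- Hypotheses on the deformation `θ`. [folklore] -/
structure ThetaHyp (θ : (Fin 4 → Site 3) → ℝ) : Prop where
  nonneg : ∀ y, 0 ≤ θ y
  le_one : ∀ y, θ y ≤ 1
  swap01 : ∀ y, θ (y ∘ ⇑(Equiv.swap (0 : Fin 4) 1)) = θ y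
  swap12 : ∀ y, θ (y ∘ ⇑(Equiv.swap (1 : Fin 4) 2)) = θ y
  swap23 : ∀ y, θ (y ∘ ⇑(Equiv.swap (2 : Fin 4) 3)) = θ y
  transl : ∀ y v, θ (fun i => y i + v) = θ y
  coincide : ∀ a x z, θ ![a, a, x, z] = 1

/-- `θ_A = 1/max(1, sep)`: merging probability `1` up to lattice distance `1`, decaying like `1/sep` in
the bulk. [folklore] -/
def θA (y : Fin 4 → Site 3) : ℝ := (max 1 (sep y))⁻¹

/-- `θ_B = 1` at coincidences, `1/2` otherwise. [folklore] -/
def θB (y : Fin 4 → Site 3) : ℝ := if sep y = 0 then 1 else 1 / 2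

/-- `θ_C = θ_A` except on the nearest-neighbour stratum `sep = 1`, where it is `1/2`. [folklore] -/
def θC (y : Fin 4 → Site 3) : ℝ := if sep y = 1 then 1 / 2 else θA y

/-- Family A. [folklore] -/
def FA : (Fin 4 → Site 3) → ℝ := Fθ θA

/-- Family B. [folklore] -/
def FB : (Fin 4 → Site 3) → ℝ := Fθ θB

/-- Family C. [folklore] -/
def FC : (Fin 4 → Site 3) → ℝ := Fθ θC

/-- The lattice direction `e₁ = (1,0,0)`. [folklore] -/
abbrev e₁ : Site 3 := Pi.single 0 1

/-- The collinear shape `(0, e₂, 2e₂, 3e₂)`. [folklore] -/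
def xs : Fin 4 → Site 3 := ![(0 : ℤ) • e₂, (1 : ℤ) • e₂, (2 : ℤ) • e₂, (3 : ℤ) • e₂]

/-- ONE-ENDED gap shape ("single-pinch avoidance law", cards `rp-unpinch-single-passage` /
`rp-gram-halving`, in the cross-Wick normalisation of `EnergyFactorisation`): the truncation
`⟨σ₀σ_{e₂} ; σ_yσ_z⟩` is at most `C·min(‖y‖,‖z‖)^{-κ'}` times its Lebowitz envelope
`⟨σ₀σ_y⟩⟨σ_{e₂}σ_z⟩ + ⟨σ₀σ_z⟩⟨σ_{e₂}σ_y⟩`, for all targets beyond some radius. [folklore] -/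
def OneEndedGapShape (S : Site 3 → Site 3 → ℝ) (F : (Fin 4 → Site 3) → ℝ) : Prop :=
  ∃ κ' C R₀ : ℝ, 0 < κ' ∧ ∀ y z : Site 3, R₀ ≤ ‖y‖ → R₀ ≤ ‖z‖ →
    F ![0, e₂, y, z] - S 0 e₂ * S y z ≤
      C * (min ‖y‖ ‖z‖) ^ (-κ') * (S 0 y * S e₂ z + S 0 z * S e₂ y)

end Summit.CriticalPhenomena.Ising3DConformalLimit.Theorems.GapForcesFarMerging.Negative

end
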